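import Summits.AnomalousDissipation.AnomalousDissipation.Theses.VirtualDissipation
import Summits.AnomalousDissipation.AnomalousDissipation.Theorems.TaylorCertificatesSteadyStatesLoudBoundedStubCompactnessSplit
import Summits.AnomalousDissipation.AnomalousDissipation.Theorems.TaylorCertificatesSteadyStatesLoudBoundedStubGpAdmissible
import Summits.AnomalousDissipation.AnomalousDissipation.Theorems.TaylorCertificatesSteadyStatesLoudBoundedStubBadSeqStrongLimit
import HarnessLib

/-!
# Line `magic-gap` (strategist ALT line, b1) — crux `VirtualDissipation.LambRigidGP` (stmt-AnomalousDissipation-15150)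

Route `route-AnomalousDissipation-VirtualDissipation`, crux #2: ν-free Lamb rigidity of the Galloway–Proctor force
`f_GP(x) = sin(2πx₃)e₁ + sin(2πx₁)e₂ + sin(2πx₂)e₃` at the energy level `E = 2` (the crux is antitone in `E`; its `E = 2`
instance is the whole crux).  Registered skeletons NOT touched by this file: `Lines/birth.lean` (Q, D) and
`Lines/conservative_cut.lean` (Q, P, L).  This is a THIRD, alternative line (crux-strategist seat
`planner-cstrat-stmt-AnomalousDissipation-15150-b1-0`, 2026-08-17); its two NEW stubs (MIX, S₀, GAP — three, of which
Q and L are shared verbatim with the earlier lines) are registered by `ledger skeleton check`.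

IDEA (THE GEODESIBLE-WAVE CUT).  A level-2 bad sequence of the crux with divergent enstrophy ("Onsager dodger") has,
after extraction, either a NON-ZERO weak cluster structure or converges weakly to `0` (a PURE microstructure).  The
WKB bookkeeping of the idea card (single modulated shear waves are silent to `O(λ⁻²)`; the refuter's enlarged-cone
condition) says exactly which pure microstructures can be silent at the rate the crux forbids: ONE wave
`U_λ = a(x) d(x) cos(λθ(x)) + O(λ⁻¹)` per point, with phase gradient `N = ∇θ = c + ∇φ` (a closed 1-form: the leaves
`θ = const`), amplitude-director `b = a d` TANGENT to the leaves (`b·N = 0`), director `d = b/|b|` DIVERGENCE FREE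
(`|b|² div b = ⟪b,(b·∇)b⟫`) and GEODESIC ON THE LEAVES (`(b·∇)b ∈ span(b, N)`): then the `O(1)` oscillatory part of
`(U_λ·∇)U_λ`, whose coefficient is `a²[(d·∇)d − (div d)d]_{∦N}`, vanishes, the mean force is `½ P div(b ⊗ b)`, the
residual is `O(λ⁻²)` in the dual norm and the roughness `O(λ)`: virtual dissipation `O(λ⁻¹) → 0`.  Conversely any
defect `δ` in the three director conditions costs residual `≍ δ/λ`, i.e. virtual dissipation `≍ δ`; so along a pure
dodger the directors are ASYMPTOTICALLY geodesible.  Hence the cut of birth's load-bearing stub D into FOUR pieces with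
a kernel-checked join `noOnsagerDodgerGP_of : MIX → S₀ → GAP → L → D`:

* `stub_noMixedDodgerGP` (MIX) — NO SYMBIOSIS: every level-2 Onsager dodger of `f_GP` has a subsequence that is
  either PURE (all Fourier modes `û_n(k) → 0`, i.e. `u_n ⇀ 0`) or STRONGLY `L²`-convergent in the closed 2-ball.  What it
  excludes: a dodger made of a standing mean flow `v ≠ 0` carrying a microstructure (the coupling constraints are severe:
  `v` tangent to the leaves, `(v·∇)b + (b·∇)v ∥ N`, `f_GP − P div(v⊗v) = ½ P div(b⊗b)` — but it is a separate bet, typed).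
* `stub_pureDodgerMagicGP` (S₀) — STRUCTURE OF PURE DODGERS: a pure level-2 Onsager dodger of `f_GP` makes `f_GP`
  MAGIC at level 2: for every `ε > 0` there is a smooth asymptotically-geodesible rank-one configuration `(c, φ, b)`
  (tangency, director-divergence and geodesic defects `≤ ε` pointwise, `|N| ≥ 1` where `|b| ≥ ε`, `∫|b|² ≤ 4 + ε`)
  producing `f_GP` within `ε` in the dual-enstrophy norm: `|½∫⟪b, Dw·b⟫ + (f_GP, w)| ≤ ε‖∇w‖₂`.  This is the
  force-blind structure theorem of the line ("below the Onsager rate, stationary microstructure is a single geodesible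
  wave"); its only known enemy is an Onsager-supercritical STATIONARY h-principle with prescribed force, not in print
  (stationary convex integration is `L^∞`: arXiv:1401.4301 Thm 1; linear source only: arXiv:2405.08390 Thm 1.1; `C^α`
  for some small `α`, unforced: arXiv:2501.13632 Thm 1.1).  Tools it answers to: H-measures / microlocal defect measures
  with a RATE (two-scale / quantitative compensated compactness), WKB.
* `stub_gpNotMagic` (GAP) — `f_GP` IS NOT MAGIC: the negation of S₀'s conclusion — a λ-FREE, sequence-free statement
  about ONE smooth configuration per `ε`: the Galloway–Proctor force is at positive distance from the asymptotically
  geodesible rank-one stresses of trace-mass `≤ 4`.  FIRST LEMMA (provable now, this seat's NOTES §GAP-linear): for FLAT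
  leaves (`φ = 0`, any `c`) and exact director conditions the representation is impossible — `c` irrational forces a
  constant director, `c ∈ ℤ³` with a zero component cannot absorb `c·f_GP` into a pressure, and for `c` with `cᵢ ≠ 0`
  the unique expansion of `(d(θ)·∇g) d(θ)` in the classes `e^{2πi xᵢ}·(functions of θ)` forces `d(θ) ∥ eⱼ − (cⱼ/cᵢ)eᵢ`
  for three pairwise non-parallel vectors at once.  Curved leaves add the normal force `½ g κ ν` and are OPEN (the route's
  own why-might-fail #1); geodesible unit fields (Sullivan, Gluck) and the rigidity of the overdetermined director system
  (geodesic AND divergence-free on each leaf) are the tools.  Numerics: kit job of this seat (E2 "gap fit").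
* `stub_noRoughStandingLimitGP` (L) — verbatim the L stub of `Lines/conservative_cut.lean` (shared obligation).
* `stub_noQuietVStateGP` (Q) — verbatim birth's Q (shared obligation).

COMPOSITION (sorry-free): `noOnsagerDodgerGP_of : MIX → S₀ → GAP → L → D` (a bad sequence that is not frequently
enstrophy-bounded is divergent; MIX extracts a pure or a strongly convergent subsequence — still a divergent level-2 bad
sequence; pure ⇒ MAGIC by S₀ ⇒ absurd by GAP; strong ⇒ its limit is a zero-work weak standing flow in the closed 2-ball by
the landed `stub_badSeqStrongLimit` ⇒ absurd by L) and `LambRigidGP_of : Q → L → MIX → S₀ → GAP → LambRigidGP` (birth's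
join: landed `stub_compactnessSplit` p85561 at `f := f_GP`, `E := 2`, smoothness from the landed `stub_gpAdmissible` p85210).
Relation to `conservative-cut`: its P (precompactness of ALL level-2 bad sequences) is, modulo landed lemmas and Rellich,
`MIX ∧ (S₀ → GAP-instance)`: P silently contains the geometric statement GAP; here it is exposed and separately staffable,
and S₀ no longer asserts anything about the geometry of `f_GP`.

Disproof used: none exists for this crux (`ledger crux ls`: no Disproof.lean, no Negative/).  Negatives index honoured:
all stubs keep the crux's mean-zero class and the energy cap; MAGIC's budget `∫|b|² ≤ 4` is the cap (wave energy `∫|b|²/2`).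
-/

-- `Summit.<Summit>.<Problem>` is the tree's mandated summit-side namespace (CONVENTIONS §2); single-conjunct summit, duplicate deliberate.
set_option linter.dupNamespace false

noncomputable section

namespace Summit.AnomalousDissipation.AnomalousDissipation.Cruxes.LambRigidGP.MagicGap

open MeasureTheory Filter Topology UnitAddTorus
open scoped InnerProductSpace ENNReal

/-! ## Stubs -/

/-- **(Q) `stub_noQuietVStateGP`** — verbatim the Q stub of `Lines/birth.lean` (shared obligation): no finite-enstrophy weak
steady Euler state of `f_GP` in the closed energy ball of level 2.  Open; size L–XL.
[FoiasManleyRosaTemam2001, Ch. II §7; arXiv:1401.4301; arXiv:2501.13632] -/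
theorem stub_noQuietVStateGP :
    ∀ u : Literature.Analysis.FunctionSpaces.Torus.energySpace (Fin 3),
      (u : Lp (EuclideanSpace ℝ (Fin 3)) 2 (volume : Measure (UnitAddTorus (Fin 3)))) ∈
          Literature.Analysis.FunctionSpaces.Torus.energySpaceV (Fin 3) →
        Literature.Analysis.FluidPDE.Torus.IsSteadyWeakSolution 0
          (fun x : UnitAddTorus (Fin 3) => (Literature.Analysis.FluidPDE.Torus.stokesMode (Pi.single (2 : Fin 3) (1 : ℤ)) (EuclideanSpace.single (0 : Fin 3) (1 : ℝ)) false x + Literature.Analysis.FluidPDE.Torus.stokesMode (Pi.single (0 : Fin 3) (1 : ℤ)) (EuclideanSpace.single (1 : Fin 3) (1 : ℝ)) false x + Literature.Analysis.FluidPDE.Torus.stokesMode (Pi.single (1 : Fin 3) (1 : ℤ)) (EuclideanSpace.single (2 : Fin 3) (1 : ℝ)) false x : EuclideanSpace ℝ (Fin 3))) u →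
        2 < ‖u‖ ^ 2 := by
  sorry

/-- **(L) `stub_noRoughStandingLimitGP`** — verbatim the L stub of `Lines/conservative_cut.lean` (shared obligation): no
zero-work weak standing flow of `f_GP` in the closed 2-ball is the strong `L²` limit of a level-2 dodger with divergent
enstrophy.  Open; size XL.  [Cruxes/SteadyStatesLoudBounded/Lines/lamb-floor-f123-shared-ceiling-S1-dodgers.md; arXiv:1401.4301; Temam1979] -/
theorem stub_noRoughStandingLimitGP :
    ∀ v : UnitAddTorus (Fin 3) → EuclideanSpace ℝ (Fin 3),
      MeasureTheory.MemLp v 2 (volume : Measure (UnitAddTorus (Fin 3))) → ∫ x, ‖v x‖ ^ 2 ≤ (2 : ℝ) →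
      (∫ x, inner ℝ (Literature.Analysis.FluidPDE.Torus.stokesMode (Pi.single (2 : Fin 3) (1 : ℤ)) (EuclideanSpace.single (0 : Fin 3) (1 : ℝ)) false x + Literature.Analysis.FluidPDE.Torus.stokesMode (Pi.single (0 : Fin 3) (1 : ℤ)) (EuclideanSpace.single (1 : Fin 3) (1 : ℝ)) false x + Literature.Analysis.FluidPDE.Torus.stokesMode (Pi.single (1 : Fin 3) (1 : ℤ)) (EuclideanSpace.single (2 : Fin 3) (1 : ℝ)) false x : EuclideanSpace ℝ (Fin 3)) (v x) = 0) →
      (∀ w : UnitAddTorus (Fin 3) → EuclideanSpace ℝ (Fin 3),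
          Literature.Analysis.FunctionSpaces.Torus.IsSmooth w → Literature.Analysis.FunctionSpaces.Torus.IsDivFree w →
          Literature.Analysis.FunctionSpaces.Torus.HasZeroMean w →
          (∫ x, inner ℝ (v x) (Literature.Analysis.FunctionSpaces.Torus.fderiv w x (v x))) +
            ∫ x, inner ℝ (Literature.Analysis.FluidPDE.Torus.stokesMode (Pi.single (2 : Fin 3) (1 : ℤ)) (EuclideanSpace.single (0 : Fin 3) (1 : ℝ)) false x + Literature.Analysis.FluidPDE.Torus.stokesMode (Pi.single (0 : Fin 3) (1 : ℤ)) (EuclideanSpace.single (1 : Fin 3) (1 : ℝ)) false x + Literature.Analysis.FluidPDE.Torus.stokesMode (Pi.single (1 : Fin 3) (1 : ℤ)) (EuclideanSpace.single (2 : Fin 3) (1 : ℝ)) false x : EuclideanSpace ℝ (Fin 3)) (w x) = 0) →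
      (∃ (u : ℕ → UnitAddTorus (Fin 3) → EuclideanSpace ℝ (Fin 3)) (R : ℕ → ℝ),
          (∀ n : ℕ, Literature.Analysis.FunctionSpaces.Torus.IsSmooth (u n) ∧
          Literature.Analysis.FunctionSpaces.Torus.IsDivFree (u n) ∧
          Literature.Analysis.FunctionSpaces.Torus.HasZeroMean (u n) ∧
          ∫ x, ‖u n x‖ ^ 2 ≤ (2 : ℝ) ∧ 0 ≤ R n ∧
          ∀ w : UnitAddTorus (Fin 3) → EuclideanSpace ℝ (Fin 3),
            Literature.Analysis.FunctionSpaces.Torus.IsSmooth w → Literature.Analysis.FunctionSpaces.Torus.IsDivFree w →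
            Literature.Analysis.FunctionSpaces.Torus.HasZeroMean w →
            |∫ x, inner ℝ (Literature.Analysis.FunctionSpaces.Torus.convect (u n) (u n) x - (Literature.Analysis.FluidPDE.Torus.stokesMode (Pi.single (2 : Fin 3) (1 : ℤ)) (EuclideanSpace.single (0 : Fin 3) (1 : ℝ)) false x + Literature.Analysis.FluidPDE.Torus.stokesMode (Pi.single (0 : Fin 3) (1 : ℤ)) (EuclideanSpace.single (1 : Fin 3) (1 : ℝ)) false x + Literature.Analysis.FluidPDE.Torus.stokesMode (Pi.single (1 : Fin 3) (1 : ℤ)) (EuclideanSpace.single (2 : Fin 3) (1 : ℝ)) false x : EuclideanSpace ℝ (Fin 3))) (w x)| ≤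
              R n * Real.sqrt (Literature.Analysis.FunctionSpaces.Torus.gradNormSq w)) ∧
          Filter.Tendsto R Filter.atTop (nhds 0) ∧
          Filter.Tendsto (fun n => R n * Real.sqrt (Literature.Analysis.FunctionSpaces.Torus.gradNormSq (u n))) Filter.atTop (nhds 0) ∧
          (∀ B : ℝ, ∃ N : ℕ, ∀ n : ℕ, N ≤ n → B < Literature.Analysis.FunctionSpaces.Torus.gradNormSq (u n)) ∧
          Filter.Tendsto (fun n => ∫ x, ‖u n x - v x‖ ^ 2) Filter.atTop (nhds 0)) →
      False := by
  sorry

/-- **(MIX) `stub_noMixedDodgerGP`** — NO SYMBIOSIS BETWEEN A STANDING FLOW AND A MICROSTRUCTURE: every level-2 bad sequence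
of `f_GP` (admissible `u_n`, `∫|u_n|² ≤ 2`, residual bounds `R_n → 0`, `R_n √(gradNormSq u_n) → 0`) with DIVERGENT enstrophy
has a subsequence `u ∘ φ` that is either PURE (`û_(φ n)(k) → 0` for every frequency `k`, i.e. weak convergence to `0` on the
bounded energy ball) or STRONGLY convergent in `L²` to some `v` with `∫|v|² ≤ 2`.  Open; size L.  Why plausibly true: a mixed
dodger needs a mean flow tangent to the leaves of the microstructure with `(v·∇)b + (b·∇)v ∥ ∇θ` and
`f_GP − P div(v ⊗ v) = ½ P div(b ⊗ b)` — an overdetermined coupling; why it might fail: exactly such a symbiosis at level 2.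
[arXiv:1401.4301; doi:10.1007/bf00251724; Cruxes/LambRigidGP/STRATEGY-CENSUS.md] -/
theorem stub_noMixedDodgerGP :
    ∀ (u : ℕ → UnitAddTorus (Fin 3) → EuclideanSpace ℝ (Fin 3)) (R : ℕ → ℝ),
      (∀ n : ℕ, Literature.Analysis.FunctionSpaces.Torus.IsSmooth (u n) ∧
          Literature.Analysis.FunctionSpaces.Torus.IsDivFree (u n) ∧
          Literature.Analysis.FunctionSpaces.Torus.HasZeroMean (u n) ∧
          ∫ x, ‖u n x‖ ^ 2 ≤ (2 : ℝ) ∧ 0 ≤ R n ∧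
          ∀ w : UnitAddTorus (Fin 3) → EuclideanSpace ℝ (Fin 3),
            Literature.Analysis.FunctionSpaces.Torus.IsSmooth w → Literature.Analysis.FunctionSpaces.Torus.IsDivFree w →
            Literature.Analysis.FunctionSpaces.Torus.HasZeroMean w →
            |∫ x, inner ℝ (Literature.Analysis.FunctionSpaces.Torus.convect (u n) (u n) x - (Literature.Analysis.FluidPDE.Torus.stokesMode (Pi.single (2 : Fin 3) (1 : ℤ)) (EuclideanSpace.single (0 : Fin 3) (1 : ℝ)) false x + Literature.Analysis.FluidPDE.Torus.stokesMode (Pi.single (0 : Fin 3) (1 : ℤ)) (EuclideanSpace.single (1 : Fin 3) (1 : ℝ)) false x + Literature.Analysis.FluidPDE.Torus.stokesMode (Pi.single (1 : Fin 3) (1 : ℤ)) (EuclideanSpace.single (2 : Fin 3) (1 : ℝ)) false x : EuclideanSpace ℝ (Fin 3))) (w x)| ≤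
              R n * Real.sqrt (Literature.Analysis.FunctionSpaces.Torus.gradNormSq w)) →
      Filter.Tendsto R Filter.atTop (nhds 0) →
      Filter.Tendsto (fun n => R n * Real.sqrt (Literature.Analysis.FunctionSpaces.Torus.gradNormSq (u n))) Filter.atTop (nhds 0) →
      (∀ B : ℝ, ∃ N : ℕ, ∀ n : ℕ, N ≤ n → B < Literature.Analysis.FunctionSpaces.Torus.gradNormSq (u n)) →
      ∃ φ : ℕ → ℕ, StrictMono φ ∧
        ((∀ k : Fin 3 → ℤ, Filter.Tendsto (fun n => UnitAddTorus.mFourierCoeff (Literature.Analysis.FunctionSpaces.EuclideanSpace.complexify ∘ (u (φ n))) k) Filter.atTop (nhds 0)) ∨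
         (∃ v : UnitAddTorus (Fin 3) → EuclideanSpace ℝ (Fin 3), MeasureTheory.MemLp v 2 (MeasureTheory.volume : MeasureTheory.Measure (UnitAddTorus (Fin 3))) ∧ ∫ x, ‖v x‖ ^ 2 ≤ (2 : ℝ) ∧ Filter.Tendsto (fun n => ∫ x, ‖u (φ n) x - v x‖ ^ 2) Filter.atTop (nhds 0))) := by
  sorry

/-- **(S₀) `stub_pureDodgerMagicGP`** — STRUCTURE OF PURE DODGERS (the force-blind structure theorem of the line): a level-2
bad sequence of `f_GP` with divergent enstrophy converging weakly to `0` (all Fourier modes `→ 0`) makes `f_GP` MAGIC at level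
2 — for every `ε > 0` a smooth ASYMPTOTICALLY GEODESIBLE RANK-ONE configuration `(c, φ, b)` (phase gradient `N = c + ∇φ` with
`|N| ≥ 1` where `|b| ≥ ε`; tangency `|⟪b, N⟫| ≤ ε`; director-divergence defect `|‖b‖² div b − ⟪b,(b·∇)b⟫| ≤ ε`; geodesic defect
`dist((b·∇)b, span(b,N)) ≤ ε`; budget `∫|b|² ≤ 4 + ε`) produces `f_GP` within `ε` in the dual-enstrophy norm.  Open; size XL
(two-scale compensated compactness with a rate; WKB).  Only known enemy: an Onsager-supercritical stationary h-principle with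
prescribed force (not in print).  [arXiv:1401.4301; arXiv:2405.08390; arXiv:2501.13632; doi:10.1007/bf00251724;
Summits/AnomalousDissipation/AnomalousDissipation/Ideas/virtual-dissipation-magic-cone.md] -/
theorem stub_pureDodgerMagicGP :
    ∀ (u : ℕ → UnitAddTorus (Fin 3) → EuclideanSpace ℝ (Fin 3)) (R : ℕ → ℝ),
      (∀ n : ℕ, Literature.Analysis.FunctionSpaces.Torus.IsSmooth (u n) ∧
          Literature.Analysis.FunctionSpaces.Torus.IsDivFree (u n) ∧
          Literature.Analysis.FunctionSpaces.Torus.HasZeroMean (u n) ∧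
          ∫ x, ‖u n x‖ ^ 2 ≤ (2 : ℝ) ∧ 0 ≤ R n ∧
          ∀ w : UnitAddTorus (Fin 3) → EuclideanSpace ℝ (Fin 3),
            Literature.Analysis.FunctionSpaces.Torus.IsSmooth w → Literature.Analysis.FunctionSpaces.Torus.IsDivFree w →
            Literature.Analysis.FunctionSpaces.Torus.HasZeroMean w →
            |∫ x, inner ℝ (Literature.Analysis.FunctionSpaces.Torus.convect (u n) (u n) x - (Literature.Analysis.FluidPDE.Torus.stokesMode (Pi.single (2 : Fin 3) (1 : ℤ)) (EuclideanSpace.single (0 : Fin 3) (1 : ℝ)) false x + Literature.Analysis.FluidPDE.Torus.stokesMode (Pi.single (0 : Fin 3) (1 : ℤ)) (EuclideanSpace.single (1 : Fin 3) (1 : ℝ)) false x + Literature.Analysis.FluidPDE.Torus.stokesMode (Pi.single (1 : Fin 3) (1 : ℤ)) (EuclideanSpace.single (2 : Fin 3) (1 : ℝ)) false x : EuclideanSpace ℝ (Fin 3))) (w x)| ≤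
              R n * Real.sqrt (Literature.Analysis.FunctionSpaces.Torus.gradNormSq w)) →
      Filter.Tendsto R Filter.atTop (nhds 0) →
      Filter.Tendsto (fun n => R n * Real.sqrt (Literature.Analysis.FunctionSpaces.Torus.gradNormSq (u n))) Filter.atTop (nhds 0) →
      (∀ B : ℝ, ∃ N : ℕ, ∀ n : ℕ, N ≤ n → B < Literature.Analysis.FunctionSpaces.Torus.gradNormSq (u n)) →
      (∀ k : Fin 3 → ℤ, Filter.Tendsto (fun n => UnitAddTorus.mFourierCoeff (Literature.Analysis.FunctionSpaces.EuclideanSpace.complexify ∘ (u n)) k) Filter.atTop (nhds 0)) →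
      (∀ ε : ℝ, 0 < ε → ∃ (c : EuclideanSpace ℝ (Fin 3)) (φ : UnitAddTorus (Fin 3) → ℝ) (b : UnitAddTorus (Fin 3) → EuclideanSpace ℝ (Fin 3)),
        Literature.Analysis.FunctionSpaces.Torus.IsSmooth φ ∧ Literature.Analysis.FunctionSpaces.Torus.IsSmooth b ∧
        (∀ x, ε ≤ ‖b x‖ → 1 ≤ ‖c + Literature.Analysis.FunctionSpaces.Torus.gradient φ x‖) ∧
        (∀ x, |inner ℝ (b x) (c + Literature.Analysis.FunctionSpaces.Torus.gradient φ x)| ≤ ε) ∧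
        (∀ x, |‖b x‖ ^ 2 * Literature.Analysis.FunctionSpaces.Torus.divergence b x - inner ℝ (b x) (Literature.Analysis.FunctionSpaces.Torus.convect b b x)| ≤ ε) ∧
        (∀ x, ∃ α β : ℝ, ‖Literature.Analysis.FunctionSpaces.Torus.convect b b x - α • b x - β • (c + Literature.Analysis.FunctionSpaces.Torus.gradient φ x)‖ ≤ ε) ∧
        ∫ x, ‖b x‖ ^ 2 ≤ (4 : ℝ) + ε ∧
        ∀ w : UnitAddTorus (Fin 3) → EuclideanSpace ℝ (Fin 3), Literature.Analysis.FunctionSpaces.Torus.IsSmooth w → Literature.Analysis.FunctionSpaces.Torus.IsDivFree w → Literature.Analysis.FunctionSpaces.Torus.HasZeroMean w →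
          |2⁻¹ * (∫ x, inner ℝ (b x) (Literature.Analysis.FunctionSpaces.Torus.fderiv w x (b x))) + ∫ x, inner ℝ (Literature.Analysis.FluidPDE.Torus.stokesMode (Pi.single (2 : Fin 3) (1 : ℤ)) (EuclideanSpace.single (0 : Fin 3) (1 : ℝ)) false x + Literature.Analysis.FluidPDE.Torus.stokesMode (Pi.single (0 : Fin 3) (1 : ℤ)) (EuclideanSpace.single (1 : Fin 3) (1 : ℝ)) false x + Literature.Analysis.FluidPDE.Torus.stokesMode (Pi.single (1 : Fin 3) (1 : ℤ)) (EuclideanSpace.single (2 : Fin 3) (1 : ℝ)) false x : EuclideanSpace ℝ (Fin 3)) (w x)| ≤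
            ε * Real.sqrt (Literature.Analysis.FunctionSpaces.Torus.gradNormSq w)) := by
  sorry

/-- **(GAP) `stub_gpNotMagic`** — THE GALLOWAY–PROCTOR FORCE IS NOT MAGIC AT LEVEL 2: there is an `ε > 0` below which no
smooth asymptotically geodesible rank-one configuration of trace-mass `≤ 4 + ε` produces `f_GP` within `ε` (the literal
negation of S₀'s conclusion).  λ-free and sequence-free; open; size L–XL.  First lemma (provable now): the flat-leaf /
linear-phase case with exact director conditions is impossible for every `c` (Fourier-class uniqueness argument, strategist
NOTES §GAP-linear; contains the refuter's linear-phase enlarged-cone exclusion); curved leaves (normal force `½ g κ ν`) are the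
open part and the route's own why-might-fail #1.  [doi:10.3934/cpaa.2012.11.1661; arXiv:1710.05205;
Summits/AnomalousDissipation/AnomalousDissipation/Ideas/virtual-dissipation-magic-cone.md; Cruxes/LambRigidGP/STRATEGY-CENSUS.md] -/
theorem stub_gpNotMagic :
    ¬ (∀ ε : ℝ, 0 < ε → ∃ (c : EuclideanSpace ℝ (Fin 3)) (φ : UnitAddTorus (Fin 3) → ℝ) (b : UnitAddTorus (Fin 3) → EuclideanSpace ℝ (Fin 3)),
        Literature.Analysis.FunctionSpaces.Torus.IsSmooth φ ∧ Literature.Analysis.FunctionSpaces.Torus.IsSmooth b ∧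
        (∀ x, ε ≤ ‖b x‖ → 1 ≤ ‖c + Literature.Analysis.FunctionSpaces.Torus.gradient φ x‖) ∧
        (∀ x, |inner ℝ (b x) (c + Literature.Analysis.FunctionSpaces.Torus.gradient φ x)| ≤ ε) ∧
        (∀ x, |‖b x‖ ^ 2 * Literature.Analysis.FunctionSpaces.Torus.divergence b x - inner ℝ (b x) (Literature.Analysis.FunctionSpaces.Torus.convect b b x)| ≤ ε) ∧
        (∀ x, ∃ α β : ℝ, ‖Literature.Analysis.FunctionSpaces.Torus.convect b b x - α • b x - β • (c + Literature.Analysis.FunctionSpaces.Torus.gradient φ x)‖ ≤ ε) ∧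
        ∫ x, ‖b x‖ ^ 2 ≤ (4 : ℝ) + ε ∧
        ∀ w : UnitAddTorus (Fin 3) → EuclideanSpace ℝ (Fin 3), Literature.Analysis.FunctionSpaces.Torus.IsSmooth w → Literature.Analysis.FunctionSpaces.Torus.IsDivFree w → Literature.Analysis.FunctionSpaces.Torus.HasZeroMean w →
          |2⁻¹ * (∫ x, inner ℝ (b x) (Literature.Analysis.FunctionSpaces.Torus.fderiv w x (b x))) + ∫ x, inner ℝ (Literature.Analysis.FluidPDE.Torus.stokesMode (Pi.single (2 : Fin 3) (1 : ℤ)) (EuclideanSpace.single (0 : Fin 3) (1 : ℝ)) false x + Literature.Analysis.FluidPDE.Torus.stokesMode (Pi.single (0 : Fin 3) (1 : ℤ)) (EuclideanSpace.single (1 : Fin 3) (1 : ℝ)) false x + Literature.Analysis.FluidPDE.Torus.stokesMode (Pi.single (1 : Fin 3) (1 : ℤ)) (EuclideanSpace.single (2 : Fin 3) (1 : ℝ)) false x : EuclideanSpace ℝ (Fin 3)) (w x)| ≤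
            ε * Real.sqrt (Literature.Analysis.FunctionSpaces.Torus.gradNormSq w)) := by
  sorry

/-! ## Name-keyed aliases of the stub statements (device of `Lines/birth.lean`): the hypotheses of the compositions -/
namespace __Registered

/-- Alias of the statement of `stub_noQuietVStateGP`, keyed by the stub name. -/
abbrev stub_noQuietVStateGP : Prop :=
  ∀ u : Literature.Analysis.FunctionSpaces.Torus.energySpace (Fin 3),
      (u : Lp (EuclideanSpace ℝ (Fin 3)) 2 (volume : Measure (UnitAddTorus (Fin 3)))) ∈
          Literature.Analysis.FunctionSpaces.Torus.energySpaceV (Fin 3) →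
        Literature.Analysis.FluidPDE.Torus.IsSteadyWeakSolution 0
          (fun x : UnitAddTorus (Fin 3) => (Literature.Analysis.FluidPDE.Torus.stokesMode (Pi.single (2 : Fin 3) (1 : ℤ)) (EuclideanSpace.single (0 : Fin 3) (1 : ℝ)) false x + Literature.Analysis.FluidPDE.Torus.stokesMode (Pi.single (0 : Fin 3) (1 : ℤ)) (EuclideanSpace.single (1 : Fin 3) (1 : ℝ)) false x + Literature.Analysis.FluidPDE.Torus.stokesMode (Pi.single (1 : Fin 3) (1 : ℤ)) (EuclideanSpace.single (2 : Fin 3) (1 : ℝ)) false x : EuclideanSpace ℝ (Fin 3))) u →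
        2 < ‖u‖ ^ 2

/-- Alias of the statement of `stub_noRoughStandingLimitGP`, keyed by the stub name. -/
abbrev stub_noRoughStandingLimitGP : Prop :=
  ∀ v : UnitAddTorus (Fin 3) → EuclideanSpace ℝ (Fin 3),
      MeasureTheory.MemLp v 2 (volume : Measure (UnitAddTorus (Fin 3))) → ∫ x, ‖v x‖ ^ 2 ≤ (2 : ℝ) →
      (∫ x, inner ℝ (Literature.Analysis.FluidPDE.Torus.stokesMode (Pi.single (2 : Fin 3) (1 : ℤ)) (EuclideanSpace.single (0 : Fin 3) (1 : ℝ)) false x + Literature.Analysis.FluidPDE.Torus.stokesMode (Pi.single (0 : Fin 3) (1 : ℤ)) (EuclideanSpace.single (1 : Fin 3) (1 : ℝ)) false x + Literature.Analysis.FluidPDE.Torus.stokesMode (Pi.single (1 : Fin 3) (1 : ℤ)) (EuclideanSpace.single (2 : Fin 3) (1 : ℝ)) false x : EuclideanSpace ℝ (Fin 3)) (v x) = 0) →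
      (∀ w : UnitAddTorus (Fin 3) → EuclideanSpace ℝ (Fin 3),
          Literature.Analysis.FunctionSpaces.Torus.IsSmooth w → Literature.Analysis.FunctionSpaces.Torus.IsDivFree w →
          Literature.Analysis.FunctionSpaces.Torus.HasZeroMean w →
          (∫ x, inner ℝ (v x) (Literature.Analysis.FunctionSpaces.Torus.fderiv w x (v x))) +
            ∫ x, inner ℝ (Literature.Analysis.FluidPDE.Torus.stokesMode (Pi.single (2 : Fin 3) (1 : ℤ)) (EuclideanSpace.single (0 : Fin 3) (1 : ℝ)) false x + Literature.Analysis.FluidPDE.Torus.stokesMode (Pi.single (0 : Fin 3) (1 : ℤ)) (EuclideanSpace.single (1 : Fin 3) (1 : ℝ)) false x + Literature.Analysis.FluidPDE.Torus.stokesMode (Pi.single (1 : Fin 3) (1 : ℤ)) (EuclideanSpace.single (2 : Fin 3) (1 : ℝ)) false x : EuclideanSpace ℝ (Fin 3)) (w x) = 0) →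
      (∃ (u : ℕ → UnitAddTorus (Fin 3) → EuclideanSpace ℝ (Fin 3)) (R : ℕ → ℝ),
          (∀ n : ℕ, Literature.Analysis.FunctionSpaces.Torus.IsSmooth (u n) ∧
          Literature.Analysis.FunctionSpaces.Torus.IsDivFree (u n) ∧
          Literature.Analysis.FunctionSpaces.Torus.HasZeroMean (u n) ∧
          ∫ x, ‖u n x‖ ^ 2 ≤ (2 : ℝ) ∧ 0 ≤ R n ∧
          ∀ w : UnitAddTorus (Fin 3) → EuclideanSpace ℝ (Fin 3),
            Literature.Analysis.FunctionSpaces.Torus.IsSmooth w → Literature.Analysis.FunctionSpaces.Torus.IsDivFree w →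
            Literature.Analysis.FunctionSpaces.Torus.HasZeroMean w →
            |∫ x, inner ℝ (Literature.Analysis.FunctionSpaces.Torus.convect (u n) (u n) x - (Literature.Analysis.FluidPDE.Torus.stokesMode (Pi.single (2 : Fin 3) (1 : ℤ)) (EuclideanSpace.single (0 : Fin 3) (1 : ℝ)) false x + Literature.Analysis.FluidPDE.Torus.stokesMode (Pi.single (0 : Fin 3) (1 : ℤ)) (EuclideanSpace.single (1 : Fin 3) (1 : ℝ)) false x + Literature.Analysis.FluidPDE.Torus.stokesMode (Pi.single (1 : Fin 3) (1 : ℤ)) (EuclideanSpace.single (2 : Fin 3) (1 : ℝ)) false x : EuclideanSpace ℝ (Fin 3))) (w x)| ≤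
              R n * Real.sqrt (Literature.Analysis.FunctionSpaces.Torus.gradNormSq w)) ∧
          Filter.Tendsto R Filter.atTop (nhds 0) ∧
          Filter.Tendsto (fun n => R n * Real.sqrt (Literature.Analysis.FunctionSpaces.Torus.gradNormSq (u n))) Filter.atTop (nhds 0) ∧
          (∀ B : ℝ, ∃ N : ℕ, ∀ n : ℕ, N ≤ n → B < Literature.Analysis.FunctionSpaces.Torus.gradNormSq (u n)) ∧
          Filter.Tendsto (fun n => ∫ x, ‖u n x - v x‖ ^ 2) Filter.atTop (nhds 0)) →
      False

/-- Alias of the statement of `stub_noMixedDodgerGP`, keyed by the stub name. -/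
abbrev stub_noMixedDodgerGP : Prop :=
  ∀ (u : ℕ → UnitAddTorus (Fin 3) → EuclideanSpace ℝ (Fin 3)) (R : ℕ → ℝ),
      (∀ n : ℕ, Literature.Analysis.FunctionSpaces.Torus.IsSmooth (u n) ∧
          Literature.Analysis.FunctionSpaces.Torus.IsDivFree (u n) ∧
          Literature.Analysis.FunctionSpaces.Torus.HasZeroMean (u n) ∧
          ∫ x, ‖u n x‖ ^ 2 ≤ (2 : ℝ) ∧ 0 ≤ R n ∧
          ∀ w : UnitAddTorus (Fin 3) → EuclideanSpace ℝ (Fin 3),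
            Literature.Analysis.FunctionSpaces.Torus.IsSmooth w → Literature.Analysis.FunctionSpaces.Torus.IsDivFree w →
            Literature.Analysis.FunctionSpaces.Torus.HasZeroMean w →
            |∫ x, inner ℝ (Literature.Analysis.FunctionSpaces.Torus.convect (u n) (u n) x - (Literature.Analysis.FluidPDE.Torus.stokesMode (Pi.single (2 : Fin 3) (1 : ℤ)) (EuclideanSpace.single (0 : Fin 3) (1 : ℝ)) false x + Literature.Analysis.FluidPDE.Torus.stokesMode (Pi.single (0 : Fin 3) (1 : ℤ)) (EuclideanSpace.single (1 : Fin 3) (1 : ℝ)) false x + Literature.Analysis.FluidPDE.Torus.stokesMode (Pi.single (1 : Fin 3) (1 : ℤ)) (EuclideanSpace.single (2 : Fin 3) (1 : ℝ)) false x : EuclideanSpace ℝ (Fin 3))) (w x)| ≤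
              R n * Real.sqrt (Literature.Analysis.FunctionSpaces.Torus.gradNormSq w)) →
      Filter.Tendsto R Filter.atTop (nhds 0) →
      Filter.Tendsto (fun n => R n * Real.sqrt (Literature.Analysis.FunctionSpaces.Torus.gradNormSq (u n))) Filter.atTop (nhds 0) →
      (∀ B : ℝ, ∃ N : ℕ, ∀ n : ℕ, N ≤ n → B < Literature.Analysis.FunctionSpaces.Torus.gradNormSq (u n)) →
      ∃ φ : ℕ → ℕ, StrictMono φ ∧
        ((∀ k : Fin 3 → ℤ, Filter.Tendsto (fun n => UnitAddTorus.mFourierCoeff (Literature.Analysis.FunctionSpaces.EuclideanSpace.complexify ∘ (u (φ n))) k) Filter.atTop (nhds 0)) ∨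
         (∃ v : UnitAddTorus (Fin 3) → EuclideanSpace ℝ (Fin 3), MeasureTheory.MemLp v 2 (MeasureTheory.volume : MeasureTheory.Measure (UnitAddTorus (Fin 3))) ∧ ∫ x, ‖v x‖ ^ 2 ≤ (2 : ℝ) ∧ Filter.Tendsto (fun n => ∫ x, ‖u (φ n) x - v x‖ ^ 2) Filter.atTop (nhds 0)))

/-- Alias of the statement of `stub_pureDodgerMagicGP`, keyed by the stub name. -/
abbrev stub_pureDodgerMagicGP : Prop :=
  ∀ (u : ℕ → UnitAddTorus (Fin 3) → EuclideanSpace ℝ (Fin 3)) (R : ℕ → ℝ),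
      (∀ n : ℕ, Literature.Analysis.FunctionSpaces.Torus.IsSmooth (u n) ∧
          Literature.Analysis.FunctionSpaces.Torus.IsDivFree (u n) ∧
          Literature.Analysis.FunctionSpaces.Torus.HasZeroMean (u n) ∧
          ∫ x, ‖u n x‖ ^ 2 ≤ (2 : ℝ) ∧ 0 ≤ R n ∧
          ∀ w : UnitAddTorus (Fin 3) → EuclideanSpace ℝ (Fin 3),
            Literature.Analysis.FunctionSpaces.Torus.IsSmooth w → Literature.Analysis.FunctionSpaces.Torus.IsDivFree w →
            Literature.Analysis.FunctionSpaces.Torus.HasZeroMean w →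
            |∫ x, inner ℝ (Literature.Analysis.FunctionSpaces.Torus.convect (u n) (u n) x - (Literature.Analysis.FluidPDE.Torus.stokesMode (Pi.single (2 : Fin 3) (1 : ℤ)) (EuclideanSpace.single (0 : Fin 3) (1 : ℝ)) false x + Literature.Analysis.FluidPDE.Torus.stokesMode (Pi.single (0 : Fin 3) (1 : ℤ)) (EuclideanSpace.single (1 : Fin 3) (1 : ℝ)) false x + Literature.Analysis.FluidPDE.Torus.stokesMode (Pi.single (1 : Fin 3) (1 : ℤ)) (EuclideanSpace.single (2 : Fin 3) (1 : ℝ)) false x : EuclideanSpace ℝ (Fin 3))) (w x)| ≤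
              R n * Real.sqrt (Literature.Analysis.FunctionSpaces.Torus.gradNormSq w)) →
      Filter.Tendsto R Filter.atTop (nhds 0) →
      Filter.Tendsto (fun n => R n * Real.sqrt (Literature.Analysis.FunctionSpaces.Torus.gradNormSq (u n))) Filter.atTop (nhds 0) →
      (∀ B : ℝ, ∃ N : ℕ, ∀ n : ℕ, N ≤ n → B < Literature.Analysis.FunctionSpaces.Torus.gradNormSq (u n)) →
      (∀ k : Fin 3 → ℤ, Filter.Tendsto (fun n => UnitAddTorus.mFourierCoeff (Literature.Analysis.FunctionSpaces.EuclideanSpace.complexify ∘ (u n)) k) Filter.atTop (nhds 0)) →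
      (∀ ε : ℝ, 0 < ε → ∃ (c : EuclideanSpace ℝ (Fin 3)) (φ : UnitAddTorus (Fin 3) → ℝ) (b : UnitAddTorus (Fin 3) → EuclideanSpace ℝ (Fin 3)),
        Literature.Analysis.FunctionSpaces.Torus.IsSmooth φ ∧ Literature.Analysis.FunctionSpaces.Torus.IsSmooth b ∧
        (∀ x, ε ≤ ‖b x‖ → 1 ≤ ‖c + Literature.Analysis.FunctionSpaces.Torus.gradient φ x‖) ∧
        (∀ x, |inner ℝ (b x) (c + Literature.Analysis.FunctionSpaces.Torus.gradient φ x)| ≤ ε) ∧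
        (∀ x, |‖b x‖ ^ 2 * Literature.Analysis.FunctionSpaces.Torus.divergence b x - inner ℝ (b x) (Literature.Analysis.FunctionSpaces.Torus.convect b b x)| ≤ ε) ∧
        (∀ x, ∃ α β : ℝ, ‖Literature.Analysis.FunctionSpaces.Torus.convect b b x - α • b x - β • (c + Literature.Analysis.FunctionSpaces.Torus.gradient φ x)‖ ≤ ε) ∧
        ∫ x, ‖b x‖ ^ 2 ≤ (4 : ℝ) + ε ∧
        ∀ w : UnitAddTorus (Fin 3) → EuclideanSpace ℝ (Fin 3), Literature.Analysis.FunctionSpaces.Torus.IsSmooth w → Literature.Analysis.FunctionSpaces.Torus.IsDivFree w → Literature.Analysis.FunctionSpaces.Torus.HasZeroMean w →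
          |2⁻¹ * (∫ x, inner ℝ (b x) (Literature.Analysis.FunctionSpaces.Torus.fderiv w x (b x))) + ∫ x, inner ℝ (Literature.Analysis.FluidPDE.Torus.stokesMode (Pi.single (2 : Fin 3) (1 : ℤ)) (EuclideanSpace.single (0 : Fin 3) (1 : ℝ)) false x + Literature.Analysis.FluidPDE.Torus.stokesMode (Pi.single (0 : Fin 3) (1 : ℤ)) (EuclideanSpace.single (1 : Fin 3) (1 : ℝ)) false x + Literature.Analysis.FluidPDE.Torus.stokesMode (Pi.single (1 : Fin 3) (1 : ℤ)) (EuclideanSpace.single (2 : Fin 3) (1 : ℝ)) false x : EuclideanSpace ℝ (Fin 3)) (w x)| ≤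
            ε * Real.sqrt (Literature.Analysis.FunctionSpaces.Torus.gradNormSq w))

/-- Alias of the statement of `stub_gpNotMagic`, keyed by the stub name. -/
abbrev stub_gpNotMagic : Prop :=
  ¬ (∀ ε : ℝ, 0 < ε → ∃ (c : EuclideanSpace ℝ (Fin 3)) (φ : UnitAddTorus (Fin 3) → ℝ) (b : UnitAddTorus (Fin 3) → EuclideanSpace ℝ (Fin 3)),
        Literature.Analysis.FunctionSpaces.Torus.IsSmooth φ ∧ Literature.Analysis.FunctionSpaces.Torus.IsSmooth b ∧
        (∀ x, ε ≤ ‖b x‖ → 1 ≤ ‖c + Literature.Analysis.FunctionSpaces.Torus.gradient φ x‖) ∧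
        (∀ x, |inner ℝ (b x) (c + Literature.Analysis.FunctionSpaces.Torus.gradient φ x)| ≤ ε) ∧
        (∀ x, |‖b x‖ ^ 2 * Literature.Analysis.FunctionSpaces.Torus.divergence b x - inner ℝ (b x) (Literature.Analysis.FunctionSpaces.Torus.convect b b x)| ≤ ε) ∧
        (∀ x, ∃ α β : ℝ, ‖Literature.Analysis.FunctionSpaces.Torus.convect b b x - α • b x - β • (c + Literature.Analysis.FunctionSpaces.Torus.gradient φ x)‖ ≤ ε) ∧
        ∫ x, ‖b x‖ ^ 2 ≤ (4 : ℝ) + ε ∧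
        ∀ w : UnitAddTorus (Fin 3) → EuclideanSpace ℝ (Fin 3), Literature.Analysis.FunctionSpaces.Torus.IsSmooth w → Literature.Analysis.FunctionSpaces.Torus.IsDivFree w → Literature.Analysis.FunctionSpaces.Torus.HasZeroMean w →
          |2⁻¹ * (∫ x, inner ℝ (b x) (Literature.Analysis.FunctionSpaces.Torus.fderiv w x (b x))) + ∫ x, inner ℝ (Literature.Analysis.FluidPDE.Torus.stokesMode (Pi.single (2 : Fin 3) (1 : ℤ)) (EuclideanSpace.single (0 : Fin 3) (1 : ℝ)) false x + Literature.Analysis.FluidPDE.Torus.stokesMode (Pi.single (0 : Fin 3) (1 : ℤ)) (EuclideanSpace.single (1 : Fin 3) (1 : ℝ)) false x + Literature.Analysis.FluidPDE.Torus.stokesMode (Pi.single (1 : Fin 3) (1 : ℤ)) (EuclideanSpace.single (2 : Fin 3) (1 : ℝ)) false x : EuclideanSpace ℝ (Fin 3)) (w x)| ≤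
            ε * Real.sqrt (Literature.Analysis.FunctionSpaces.Torus.gradNormSq w))

end __Registered

/-! ## Compositions -/

/-- **The cut of birth's D**: no mixed dodgers (MIX), the structure of pure dodgers (S₀), `f_GP` not magic (GAP) and no
rough conservative standing-flow limits (L) imply that every level-2 bad sequence of `f_GP` is frequently enstrophy-bounded —
literally the statement of `Lines/birth.lean`'s `stub_noOnsagerDodgerGP`.  Proof: a bad sequence that is NOT frequently
bounded is divergent; MIX extracts a subsequence (still a divergent level-2 bad sequence) that is pure or strongly convergent;
pure ⇒ `f_GP` magic (S₀) ⇒ absurd (GAP); strongly convergent ⇒ its limit does zero work and solves steady Euler weakly by the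
landed `stub_badSeqStrongLimit` (f := f_GP, smooth by the landed `stub_gpAdmissible`) ⇒ absurd (L). -/
theorem noOnsagerDodgerGP_of (hM : __Registered.stub_noMixedDodgerGP) (hS : __Registered.stub_pureDodgerMagicGP)
    (hG : __Registered.stub_gpNotMagic) (hL : __Registered.stub_noRoughStandingLimitGP) :
    ∀ (u : ℕ → UnitAddTorus (Fin 3) → EuclideanSpace ℝ (Fin 3)) (R : ℕ → ℝ),
      (∀ n : ℕ, Literature.Analysis.FunctionSpaces.Torus.IsSmooth (u n) ∧
          Literature.Analysis.FunctionSpaces.Torus.IsDivFree (u n) ∧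
          Literature.Analysis.FunctionSpaces.Torus.HasZeroMean (u n) ∧
          ∫ x, ‖u n x‖ ^ 2 ≤ (2 : ℝ) ∧ 0 ≤ R n ∧
          ∀ w : UnitAddTorus (Fin 3) → EuclideanSpace ℝ (Fin 3),
            Literature.Analysis.FunctionSpaces.Torus.IsSmooth w → Literature.Analysis.FunctionSpaces.Torus.IsDivFree w →
            Literature.Analysis.FunctionSpaces.Torus.HasZeroMean w →
            |∫ x, inner ℝ (Literature.Analysis.FunctionSpaces.Torus.convect (u n) (u n) x - (Literature.Analysis.FluidPDE.Torus.stokesMode (Pi.single (2 : Fin 3) (1 : ℤ)) (EuclideanSpace.single (0 : Fin 3) (1 : ℝ)) false x + Literature.Analysis.FluidPDE.Torus.stokesMode (Pi.single (0 : Fin 3) (1 : ℤ)) (EuclideanSpace.single (1 : Fin 3) (1 : ℝ)) false x + Literature.Analysis.FluidPDE.Torus.stokesMode (Pi.single (1 : Fin 3) (1 : ℤ)) (EuclideanSpace.single (2 : Fin 3) (1 : ℝ)) false x : EuclideanSpace ℝ (Fin 3))) (w x)| ≤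
              R n * Real.sqrt (Literature.Analysis.FunctionSpaces.Torus.gradNormSq w)) →
      Filter.Tendsto R Filter.atTop (nhds 0) →
      Filter.Tendsto (fun n => R n * Real.sqrt (Literature.Analysis.FunctionSpaces.Torus.gradNormSq (u n))) Filter.atTop (nhds 0) →
      ∃ B : ℝ, ∀ N : ℕ, ∃ n : ℕ, N ≤ n ∧ Literature.Analysis.FunctionSpaces.Torus.gradNormSq (u n) ≤ B := by
  dsimp only [__Registered.stub_noMixedDodgerGP, __Registered.stub_pureDodgerMagicGP, __Registered.stub_gpNotMagic,
    __Registered.stub_noRoughStandingLimitGP] at hM hS hG hL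
  intro u R hbad hR hRG
  by_contra hD
  push Not at hD
  -- hD : ∀ B, ∃ N, ∀ n, N ≤ n → B < gradNormSq (u n)
  obtain ⟨φ, hφ, hcase⟩ := hM u R hbad hR hRG hD
  have hφt : Filter.Tendsto φ Filter.atTop Filter.atTop := hφ.tendsto_atTop
  have hbad' : (∀ n : ℕ, Literature.Analysis.FunctionSpaces.Torus.IsSmooth ((fun n => u (φ n)) n) ∧
      Literature.Analysis.FunctionSpaces.Torus.IsDivFree ((fun n => u (φ n)) n) ∧
      Literature.Analysis.FunctionSpaces.Torus.HasZeroMean ((fun n => u (φ n)) n) ∧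
      ∫ x, ‖(fun n => u (φ n)) n x‖ ^ 2 ≤ (2 : ℝ) ∧ 0 ≤ (fun n => R (φ n)) n ∧
      ∀ w : UnitAddTorus (Fin 3) → EuclideanSpace ℝ (Fin 3),
        Literature.Analysis.FunctionSpaces.Torus.IsSmooth w → Literature.Analysis.FunctionSpaces.Torus.IsDivFree w →
        Literature.Analysis.FunctionSpaces.Torus.HasZeroMean w →
        |∫ x, inner ℝ (Literature.Analysis.FunctionSpaces.Torus.convect ((fun n => u (φ n)) n) ((fun n => u (φ n)) n) x - (Literature.Analysis.FluidPDE.Torus.stokesMode (Pi.single (2 : Fin 3) (1 : ℤ)) (EuclideanSpace.single (0 : Fin 3) (1 : ℝ)) false x + Literature.Analysis.FluidPDE.Torus.stokesMode (Pi.single (0 : Fin 3) (1 : ℤ)) (EuclideanSpace.single (1 : Fin 3) (1 : ℝ)) false x + Literature.Analysis.FluidPDE.Torus.stokesMode (Pi.single (1 : Fin 3) (1 : ℤ)) (EuclideanSpace.single (2 : Fin 3) (1 : ℝ)) false x : EuclideanSpace ℝ (Fin 3))) (w x)| ≤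
          (fun n => R (φ n)) n * Real.sqrt (Literature.Analysis.FunctionSpaces.Torus.gradNormSq w)) := fun n => hbad (φ n)
  have hR' : Filter.Tendsto (fun n => R (φ n)) Filter.atTop (nhds 0) := hR.comp hφt
  have hRG' : Filter.Tendsto (fun n => (fun n => R (φ n)) n * Real.sqrt (Literature.Analysis.FunctionSpaces.Torus.gradNormSq ((fun n => u (φ n)) n)))
      Filter.atTop (nhds 0) := hRG.comp hφt
  have hdiv' : ∀ B : ℝ, ∃ N : ℕ, ∀ n : ℕ, N ≤ n → B < Literature.Analysis.FunctionSpaces.Torus.gradNormSq ((fun n => u (φ n)) n) := by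
    intro B
    obtain ⟨N, hN⟩ := hD B
    exact ⟨N, fun n hn => hN (φ n) (hn.trans hφ.le_apply)⟩
  rcases hcase with hpure | ⟨v, hv, hv2, hconv⟩
  · exact hG (hS (fun n => u (φ n)) (fun n => R (φ n)) hbad' hR' hRG' hdiv' hpure)
  · obtain ⟨hfs, -, -⟩ :=
      Summit.AnomalousDissipation.AnomalousDissipation.Theorems.SteadyStatesLoudBounded.GpAdmissible.stub_gpAdmissible
    have hseq : ∀ n : ℕ, Literature.Analysis.FunctionSpaces.Torus.IsSmooth (u (φ n)) ∧
        Literature.Analysis.FunctionSpaces.Torus.IsDivFree (u (φ n)) ∧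
        Literature.Analysis.FunctionSpaces.Torus.HasZeroMean (u (φ n)) ∧ 0 ≤ R (φ n) ∧
        ∀ w : UnitAddTorus (Fin 3) → EuclideanSpace ℝ (Fin 3),
          Literature.Analysis.FunctionSpaces.Torus.IsSmooth w → Literature.Analysis.FunctionSpaces.Torus.IsDivFree w →
          Literature.Analysis.FunctionSpaces.Torus.HasZeroMean w →
          |∫ x, inner ℝ (Literature.Analysis.FunctionSpaces.Torus.convect (u (φ n)) (u (φ n)) x -
              (fun x : UnitAddTorus (Fin 3) => (Literature.Analysis.FluidPDE.Torus.stokesMode (Pi.single (2 : Fin 3) (1 : ℤ)) (EuclideanSpace.single (0 : Fin 3) (1 : ℝ)) false x + Literature.Analysis.FluidPDE.Torus.stokesMode (Pi.single (0 : Fin 3) (1 : ℤ)) (EuclideanSpace.single (1 : Fin 3) (1 : ℝ)) false x + Literature.Analysis.FluidPDE.Torus.stokesMode (Pi.single (1 : Fin 3) (1 : ℤ)) (EuclideanSpace.single (2 : Fin 3) (1 : ℝ)) false x : EuclideanSpace ℝ (Fin 3))) x) (w x)| ≤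
            R (φ n) * Real.sqrt (Literature.Analysis.FunctionSpaces.Torus.gradNormSq w) := fun n =>
      ⟨(hbad (φ n)).1, (hbad (φ n)).2.1, (hbad (φ n)).2.2.1, (hbad (φ n)).2.2.2.2.1, (hbad (φ n)).2.2.2.2.2⟩
    obtain ⟨hwork, hweak⟩ :=
      Summit.AnomalousDissipation.AnomalousDissipation.Theorems.SteadyStatesLoudBounded.BadSeqStrongLimit.stub_badSeqStrongLimit
        (fun x : UnitAddTorus (Fin 3) => (Literature.Analysis.FluidPDE.Torus.stokesMode (Pi.single (2 : Fin 3) (1 : ℤ)) (EuclideanSpace.single (0 : Fin 3) (1 : ℝ)) false x + Literature.Analysis.FluidPDE.Torus.stokesMode (Pi.single (0 : Fin 3) (1 : ℤ)) (EuclideanSpace.single (1 : Fin 3) (1 : ℝ)) false x + Literature.Analysis.FluidPDE.Torus.stokesMode (Pi.single (1 : Fin 3) (1 : ℤ)) (EuclideanSpace.single (2 : Fin 3) (1 : ℝ)) false x : EuclideanSpace ℝ (Fin 3)))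
        v (fun n => u (φ n)) (fun n => R (φ n)) hfs hseq hR' hRG' hv hconv
    exact hL v hv hv2 hwork hweak ⟨fun n => u (φ n), fun n => R (φ n), hbad', hR', hRG', hdiv', hconv⟩

/-- **Composition** (kernel-checked, no `sorry` of its own): Q, L, MIX, S₀, GAP imply the crux
`Summit.AnomalousDissipation.AnomalousDissipation.Theses.VirtualDissipation.LambRigidGP` BY NAME — birth's join (landed
`stub_compactnessSplit`, p85561, at `f := f_GP`, `E := 2`; smoothness of `f_GP` from the landed `stub_gpAdmissible`, p85210)
fed with D := `noOnsagerDodgerGP_of MIX S₀ GAP L`; energy witness `E := 2`. -/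
theorem LambRigidGP_of :
    __Registered.stub_noQuietVStateGP → __Registered.stub_noRoughStandingLimitGP → __Registered.stub_noMixedDodgerGP →
      __Registered.stub_pureDodgerMagicGP → __Registered.stub_gpNotMagic →
      Summit.AnomalousDissipation.AnomalousDissipation.Theses.VirtualDissipation.LambRigidGP := by
  intro hQ hL hM hS hG
  have hD := noOnsagerDodgerGP_of hM hS hG hL
  dsimp only [__Registered.stub_noQuietVStateGP] at hQ
  obtain ⟨hfs, -, -⟩ :=
    Summit.AnomalousDissipation.AnomalousDissipation.Theorems.SteadyStatesLoudBounded.GpAdmissible.stub_gpAdmissible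
  obtain ⟨c, δ₀, hc, hδ₀, hrig⟩ :=
    Summit.AnomalousDissipation.AnomalousDissipation.Theorems.SteadyStatesLoudBounded.CompactnessSplit.stub_compactnessSplit
      (fun x : UnitAddTorus (Fin 3) => (Literature.Analysis.FluidPDE.Torus.stokesMode (Pi.single (2 : Fin 3) (1 : ℤ)) (EuclideanSpace.single (0 : Fin 3) (1 : ℝ)) false x + Literature.Analysis.FluidPDE.Torus.stokesMode (Pi.single (0 : Fin 3) (1 : ℤ)) (EuclideanSpace.single (1 : Fin 3) (1 : ℝ)) false x + Literature.Analysis.FluidPDE.Torus.stokesMode (Pi.single (1 : Fin 3) (1 : ℤ)) (EuclideanSpace.single (2 : Fin 3) (1 : ℝ)) false x : EuclideanSpace ℝ (Fin 3)))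
      2 hfs hQ hD
  unfold Summit.AnomalousDissipation.AnomalousDissipation.Theses.VirtualDissipation.LambRigidGP
  exact ⟨2, c, δ₀, le_refl _, hc, hδ₀, hrig⟩

/-- WIRING CHECK: the five sorried stubs compose to a closed term of the crux's type (modulo their `sorry`s).
Deliberately an `example` (no constant enters the environment). -/
example : Summit.AnomalousDissipation.AnomalousDissipation.Theses.VirtualDissipation.LambRigidGP :=
  LambRigidGP_of stub_noQuietVStateGP stub_noRoughStandingLimitGP stub_noMixedDodgerGP stub_pureDodgerMagicGP
    stub_gpNotMagic

end Summit.AnomalousDissipation.AnomalousDissipation.Cruxes.LambRigidGP.MagicGap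

end
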